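import Mathlib
import Literature.MathematicalPhysics.QuantumFieldTheory.MagnenRivasseauSeneor1993.MRS93GhostReintegration
import Literature.MathematicalPhysics.QuantumFieldTheory.MagnenRivasseauSeneor1993.MRS93TruncatedGauge
import HarnessLib

/-!
# Magnen–Rivasseau–Sénéor (CMP 155, 1993): (II.43)–(II.45) p.341–342 — «this measure can be recomputed exactly in
# terms of A′ = A^{γ,2}»: the change of variables `A = T⁻¹(A′ − U)` in the Gaussian measure `dμ_{0,ρ₁}`,
# `dμ_{0,ρ₁}(A) = dμ_{0,ρ₁}(A′) G(A′,γ)/∫G(A′,γ)dμ_{0,ρ₁}(A′)` (II.44) PROVED in finite dimensions with the EXACT factor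
# `G`; the printed (II.45) typed verbatim beside it and both exponents in closed form; (II.43) `|det ⊕_x T(γ(x))| =
# Π_x (1 + λ²γ²(x))` for the print's own `T` of (II.41)

statement-level skeleton of published definitions with citation tags; bookkeeping proved; nothing here is a claim
about the Yang–Mills mass gap, about continuum Yang–Mills on `T⁴` without infrared cutoff, or about the Clay problem —
and nothing of Magnen–Rivasseau–Sénéor's analysis (expansions, bounds, limits) is asserted or formalised

**Citation header (reproduction of PUBLISHED work).** J. Magnen, V. Rivasseau, R. Sénéor, *Construction of YM₄ with
an infrared cutoff*, Commun. Math. Phys. **155** (1993) 325–383 [MagnenRivasseauSeneor1993], Sect. II.D p.341 tl.12–44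
and p.342 tl.1–4: (II.41)–(II.43) p.341 tl.20–35, (II.44) p.341 tl.36–44, (II.45) p.342 tl.1–4. Loci `p.NNN tl.nn` =
journal page / text-layer line of the held scan `paper:magnen1993-cmp155-mrs-ym4-infrared-cutoff` (PDF page = journal
page − 324); displays read on the decoded page IMAGES (renders of record `run/shared/lean/pub/lit-balaban/inprint/
lit-balaban-p14/renders-cmp155/p17_full_s6.png`, `p18_full_s6.png`; 2× crops `p17_crop_r4300-5400_s2.png` ((II.44)),
`p18_crop_r400-1000_s2.png` + `p18_crop_r950-1250_s2.png` ((II.45)) in the gen-6 seat folder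
`run/shared/lean/pub/pub-balaban-gaps/pub-balaban-gaps-mrs-lit-1/g6/renders/`). Cell pub-balaban-gaps, track G3, seat
mrs-lit-1 (gen 6); companion prose `run/shared/lean/pub/pub-balaban-gaps/g3/MRS-AS-PRINTED.md` §2, §5. Builds on
`…MRS93GhostReintegration` (gen 6: READING (FD), `gaussZ`, `gaussExpect`, `integral_comp_mulVec` — Lebesgue under linear
maps — and `mulVec_dotProduct_eq_dotProduct_transpose_mulVec`) and `…MRS93TruncatedGauge` (gen 0: the one-site matrices
`Tmat` (II.41), `TinvMat`/`Hmat` (II.42), `det_Tmat`, `jacobianJ` (II.43)).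

**Why this file.** After `…MRS93GhostReintegration` the seat record's INVENTORY of the bare ansatz (II.78) listed two
untyped factors: `χ_LFR` (the outcome of the large/small-field expansions — not definition-complete in print) and
`G(A′,γ)` of (II.45) («position⊗momentum operator products, XL» in the momentum-space vocabulary). In the
finite-dimensional reading (FD) introduced for (II.71)–(II.76), `G` IS typable, and the sentence it comes from — (II.44),
«this measure can be recomputed exactly in terms of A′» — is a THEOREM about Gaussian integrals under an affine change
of variables. This file types (II.44)/(II.45) that way, leaving `χ_LFR` as the only factor of (II.78) without a typed
body.

**What the paper prints (verbatim, from the page images).**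
* p.341 tl.26–35: *«the transformation A → A′ is therefore inverted by A = T⁻¹(A′ − U). Furthermore the Jacobian of the
  change of variables associated to a true gauge transformation is one, since the linear piece is an inner automorphism.
  For the truncated gauge transformation this is no longer exactly true. For instance for the truncated transformation
  A → A^{γ,2} the linear piece is A → TA, and the Jacobian is J(γ) ≡ (1 + λ²γ²)⁻¹. The formal Lebesgue measure changes
  therefore, if A′ = A^{γ,2} as: Π_x dA(x) → Π_x dA′(x) Π_x (1 + λ²γ²(x))⁻¹. (II.43)»*
* p.341 tl.36–44: *«Since we use Gaussian measures, we have a well defined analogue of this formal formula. Let us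
  consider again dμ_{0,ρ₁}(A) which is the initial normalized Gaussian measure with propagator C_{0,ρ₁} used to define
  our functional integral over A. This measure can be recomputed exactly in terms of A′ = A^{γ,2} using as a guide the
  following formal manipulations: A = T⁻¹(A′ − U(γ)), dμ_{0,ρ₁}(A) = e^{−(1/2)AC⁻¹_{0,ρ₁}A}dA / ∫e^{−(1/2)AC⁻¹_{0,ρ₁}A}dA
  = e^{−(1/2)(A′−U)(Tᵗʳ)⁻¹C⁻¹_{0,ρ₁}T⁻¹(A′−U)}J(γ)dA′ / ∫e^{−(1/2)(A′−U)(Tᵗʳ)⁻¹C⁻¹_{0,ρ₁}T⁻¹(A′−U)}J(γ)dA′ = dμ_{0,ρ₁}(A′)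
  G(A′,γ)/∫G(A′,γ)dμ_{0,ρ₁}(A′), (II.44)»*
* p.342 tl.1–4: *«where G contains correction terms in the difference H between T⁻¹ and Id, and terms in U: G(A′,γ) ≡
  e^{+A′ᵗHᵗʳC⁻¹_{0,ρ₁}T⁻¹A′ + A′ᵗ(Tᵗʳ)⁻¹C⁻¹_{0,ρ₁}HA′ − A′ᵗHᵗʳC⁻¹_{0,ρ₁}HA′} × e^{+A′ᵗ(Tᵗʳ)⁻¹C⁻¹_{0,ρ₁}T⁻¹U +
  Uᵗʳ(Tᵗʳ)⁻¹C⁻¹_{0,ρ₁}T⁻¹A′ − Uᵗʳ(Tᵗʳ)⁻¹C⁻¹_{0,ρ₁}T⁻¹U}. (II.45)»*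

**What is typed here (definitions with bodies; bookkeeping kernel-checked, zero `sorry`, zero named facts)**, all in
the sub-namespace `MainStatement.GhostGaussian` of `…MRS93GhostReintegration` (READING (FD): real matrices/vectors on a
finite index type = the window coordinates of `A′`).
* §1 `hMat T = T⁻¹ − 1` («the difference H between T⁻¹ and Id»), `mMat T Cinv = (Tᵗʳ)⁻¹C⁻¹T⁻¹`, **`gPrinted`** = (II.45)
  VERBATIM (the six printed terms, signs as printed), **`gExact`** = `e^{−½(A′−U)ᵀ(Tᵗʳ)⁻¹C⁻¹T⁻¹(A′−U) + ½A′ᵀC⁻¹A′}` = the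
  density that (II.44)'s middle expression defines relative to `dμ_{0,ρ₁}(A′)` (the `A′`-independent `J(γ)` cancels in
  the printed ratio and is omitted).
* §2 **(II.44) PROVED**: `dotProduct_mMat_mulVec` (`(TA)ᵀM(TA) = AᵀC⁻¹A`), **`integral_affine_change`** (Lebesgue form:
  `∫dA′ F(T⁻¹(A′−U)) e^{−½(A′−U)ᵀM(A′−U)} = |det T| ∫dA F(A) e^{−½AᵀC⁻¹A}` — translation invariance + the linear change
  of variables of `…GhostReintegration` §6), `gaussWeight_mul_gExact`, **`gaussExpect_transport`** (`∫F(T⁻¹(A′−U))G_exact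
  dμ(A′) = |det T|·∫F dμ`), **`gaussExpect_affine_change`** = (II.44): `∫F dμ = ∫F(T⁻¹(A′−U))G_exact dμ(A′) / ∫G_exact
  dμ(A′)` for every invertible `T`, every `U`, every normalisable `C⁻¹` (`Z ≠ 0`) and a.e.-strongly-measurable `F`.
* §3 the exponents in closed form: **`hMat_combination`** (`HᵗʳC⁻¹T⁻¹ + (Tᵗʳ)⁻¹C⁻¹H − HᵗʳC⁻¹H = (Tᵗʳ)⁻¹C⁻¹T⁻¹ − C⁻¹`
  for `H = T⁻¹ − 1`, PROVED — the printed «correction terms in the difference H between T⁻¹ and Id»), **`gPrinted_eq`**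
  (`log G_printed = A′ᵀ(M−C⁻¹)A′ + (A′ᵀMU + UᵀMA′) − UᵀMU`), **`gExact_eq`** (`log G_exact = −½A′ᵀ(M−C⁻¹)A′ + ½(A′ᵀMU +
  UᵀMA′) − ½UᵀMU`), **`gPrinted_eq_gExact_rel`** (AS-PRINTED PRECISION (r), exhibited: `G_printed = G_exact⁻²·e^{2(A′ᵀMU
  + UᵀMA′) − 2UᵀMU}`), `gPrinted_one_zero` (both are `1` at `T = 1`, `U = 0`).
* §4 the print's own `T`: `hMat_Tmat` (one site: the `H` of (II.45) IS the tree's (II.42) `Hmat`), `isUnit_det_Tmat`,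
  `abs_det_Tmat` (`|det T(γ)| = J(γ)⁻¹`), **`blockT`** = `⊕_x T(γ(x))` on `Fin 3 × X` for a finite set of sites,
  `det_blockT`, `isUnit_det_blockT`, **`abs_det_blockT`** = (II.43) (`|det ⊕_x T(γ(x))| = Π_x (1+λ²γ²(x)) = Π_x J(γ(x))⁻¹`),
  **`gaussExpect_affine_change_blockT`** ((II.44) for `T = ⊕_x T(γ(x))`, unconditionally in `λ`, `γ`), and
  **`gaussExpect_gExact_blockT`** (`∫G_exact dμ_{0,ρ₁}(A′) = Π_x (1 + λ²γ²(x))`, a function of `γ` alone).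

**Readings (declared).** (FD) of `…GhostReintegration`: `dμ_{0,ρ₁}` restricted to the finitely many window coordinates
of `A′` is the normalised Gaussian `gaussExpect C⁻¹` for a real matrix `C⁻¹` with `Z(C⁻¹) ≠ 0` (its identification with
the tree's infinite-product, realified `muZero par ρ₁` — independent coordinates = real/imaginary parts at positive
momenta, variances `C₀(p)κ_{ρ₁}(p)`, dead modes pinned — is NOT re-proved here); `T` an arbitrary invertible matrix (§4:
the print's block-diagonal `⊕_x T(γ(x))` on a finite set of position-space sites — the finite window in position space is
part of the reading), `U` an arbitrary vector (in print `U = ∂γ + (λ/2)[γ,∂γ]`, p.341 tl.20 with the `λ` of finding (k)).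
The pointwise objects `T(γ)`, `T⁻¹ = 1 + H`, `J(γ)` are the tree's (`…TruncatedGauge`).

**As-printed precision recorded (kernel-exhibited; not adjudicated; does not affect the argument).** (r) (II.45) as
printed is not the factor that makes (II.44) an identity: completing (II.44)'s own middle expression gives `G_exact`
(`gaussExpect_affine_change` PROVED with it), and `G_printed = G_exact⁻² · e^{2(A′ᵀMU+UᵀMA′) − 2UᵀMU}`
(`gPrinted_eq_gExact_rel`) — the print drops the Gaussian `−½` on the «correction terms» and carries the `U`-terms with
the signs shown («using as a guide the following formal manipulations», p.341 tl.38–39). `G` enters (II.49)/(II.78) only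
through the normalised ratio `G/∫G dμ_{0,ρ₁}` of (II.44). Earlier precisions (k)–(q) are in the sibling files.

**Honest status / what is NOT claimed.** Typed: (II.43)–(II.45) as definitions and identities in READING (FD). NOT
typed / NOT claimed: that `H` is «a small matrix» or any size estimate on `G`; the infinite-dimensional (all modes)
statement; the identification of (FD) with the tree's `muZero`; anything about `χ_LFR`, `K_{ρ,ρ₂}`, `CT_ρ`, or the
normalisability of (II.49)/(II.78). Nothing here bears on Bałaban's papers; nothing is continuum YM₄ on `T⁴`, nothing
lifts the infrared cutoff, nothing is Clay.
-/

noncomputable section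

open MeasureTheory Finset
open scoped NNReal ENNReal Matrix

namespace Literature.MathematicalPhysics.QuantumFieldTheory.MagnenRivasseauSeneor1993

namespace MainStatement

namespace GhostGaussian

variable {κ : Type*} [Fintype κ] [DecidableEq κ]

/-! ## §1 (II.44)/(II.45): the objects -/

/-- `H`, «the difference H between T⁻¹ and Id» ((II.42) `T⁻¹_ab = δ_ab + H_ab`; pointwise `TruncatedGauge.Hmat`):
`H = T⁻¹ − 1`. [cite: MagnenRivasseauSeneor1993, (II.42) p.341 tl.29–31, (II.45) p.342 tl.1–2] -/
def hMat (T : Matrix κ κ ℝ) : Matrix κ κ ℝ := T⁻¹ - 1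

/-- The transported inverse propagator `(Tᵗʳ)⁻¹ C₀,ρ₁⁻¹ T⁻¹` of (II.44). [cite: MagnenRivasseauSeneor1993, (II.44) p.341 tl.39–41] -/
def mMat (T Cinv : Matrix κ κ ℝ) : Matrix κ κ ℝ := T⁻¹ᵀ * Cinv * T⁻¹

/-- **(II.45) AS PRINTED**: `G(A′,γ) ≡ e^{+A′ᵗHᵗʳC⁻¹T⁻¹A′ + A′ᵗ(Tᵗʳ)⁻¹C⁻¹HA′ − A′ᵗHᵗʳC⁻¹HA′} ×
e^{+A′ᵗ(Tᵗʳ)⁻¹C⁻¹T⁻¹U + Uᵗʳ(Tᵗʳ)⁻¹C⁻¹T⁻¹A′ − Uᵗʳ(Tᵗʳ)⁻¹C⁻¹T⁻¹U}` (`C⁻¹ = C₀,ρ₁⁻¹`; READING (FD): `A′`, `U` vectors of the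
window coordinates, `T` the (block-diagonal) truncated-gauge matrix, `H = T⁻¹ − 1`).
[cite: MagnenRivasseauSeneor1993, (II.45) p.342 tl.1–4] -/
def gPrinted (T Cinv : Matrix κ κ ℝ) (U A' : κ → ℝ) : ℝ :=
  Real.exp (A' ⬝ᵥ (((hMat T)ᵀ * Cinv * T⁻¹) *ᵥ A') + A' ⬝ᵥ ((T⁻¹ᵀ * Cinv * hMat T) *ᵥ A') -
      A' ⬝ᵥ (((hMat T)ᵀ * Cinv * hMat T) *ᵥ A')) *
    Real.exp (A' ⬝ᵥ (mMat T Cinv *ᵥ U) + U ⬝ᵥ (mMat T Cinv *ᵥ A') - U ⬝ᵥ (mMat T Cinv *ᵥ U))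

/-- **The EXACT factor of (II.44)**: the density of `e^{−½(A′−U)ᵀ(Tᵗʳ)⁻¹C⁻¹T⁻¹(A′−U)}` relative to `e^{−½A′ᵀC⁻¹A′}`,
`G_exact(A′) = e^{−½(A′−U)ᵀM(A′−U) + ½A′ᵀC⁻¹A′}`, `M = (Tᵗʳ)⁻¹C⁻¹T⁻¹` (`J(γ)`, an `A′`-independent constant in (II.44),
cancels in the printed ratio and is omitted). [cite: MagnenRivasseauSeneor1993, (II.44) p.341 tl.36–42] -/
def gExact (T Cinv : Matrix κ κ ℝ) (U A' : κ → ℝ) : ℝ :=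
  Real.exp (-(1 / 2 : ℝ) * ((A' - U) ⬝ᵥ (mMat T Cinv *ᵥ (A' - U))) + (1 / 2 : ℝ) * (A' ⬝ᵥ (Cinv *ᵥ A')))

/-! ## §2 (II.44) PROVED in finite dimensions: under `A = T⁻¹(A′ − U)` the normalised Gaussian integral recomputes as
`∫ F(A) dμ_{0,ρ₁}(A) = ∫ F(T⁻¹(A′−U)) G(A′,γ) dμ_{0,ρ₁}(A′) / ∫ G(A′,γ) dμ_{0,ρ₁}(A′)` with the EXACT factor `G_exact` -/

/-- The transported form pulled back by `T` is the original form: `(TA)ᵀ (Tᵗʳ)⁻¹C⁻¹T⁻¹ (TA) = AᵀC⁻¹A`.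
[cite: MagnenRivasseauSeneor1993, (II.44) p.341 tl.36–42] -/
theorem dotProduct_mMat_mulVec (T Cinv : Matrix κ κ ℝ) (hT : IsUnit T.det) (A : κ → ℝ) :
    (T *ᵥ A) ⬝ᵥ (mMat T Cinv *ᵥ (T *ᵥ A)) = A ⬝ᵥ (Cinv *ᵥ A) := by
  unfold mMat
  rw [Matrix.mulVec_mulVec, Matrix.mul_assoc, Matrix.nonsing_inv_mul _ hT, Matrix.mul_one, ← Matrix.mulVec_mulVec,
    mulVec_dotProduct_eq_dotProduct_transpose_mulVec, Matrix.mulVec_mulVec, ← Matrix.transpose_mul,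
    Matrix.nonsing_inv_mul _ hT, Matrix.transpose_one, Matrix.one_mulVec]

/-- **The change of variables `A = T⁻¹(A′ − U)` under the Gaussian weight, PROVED** (Lebesgue form): for invertible `T`,
`∫ dA′ F(T⁻¹(A′−U)) e^{−½(A′−U)ᵀ(Tᵗʳ)⁻¹C⁻¹T⁻¹(A′−U)} = |det T| ∫ dA F(A) e^{−½AᵀC⁻¹A}` — the middle equality of (II.44)
(the print's pointwise Jacobian `J(γ) = (1+λ²γ²)⁻¹ = (det T)⁻¹`, `TruncatedGauge.det_Tmat_mul_jacobianJ`, is the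
`|det T|` here). [cite: MagnenRivasseauSeneor1993, (II.44) p.341 tl.36–42, (II.43) p.341 tl.33–35] -/
theorem integral_affine_change (T Cinv : Matrix κ κ ℝ) (hT : IsUnit T.det) (U : κ → ℝ) {F : (κ → ℝ) → ℝ}
    (hF : AEStronglyMeasurable F volume) :
    ∫ A', F (T⁻¹ *ᵥ (A' - U)) * Real.exp (-(1 / 2 : ℝ) * ((A' - U) ⬝ᵥ (mMat T Cinv *ᵥ (A' - U)))) =
      |T.det| * ∫ A, F A * Real.exp (-(1 / 2 : ℝ) * (A ⬝ᵥ (Cinv *ᵥ A))) := by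
  have hTinv : T⁻¹.det ≠ 0 := by
    rw [Matrix.det_nonsing_inv, Ring.inverse_eq_inv]; exact inv_ne_zero hT.ne_zero
  have hTT : ∀ y : κ → ℝ, T *ᵥ (T⁻¹ *ᵥ y) = y := fun y => by
    rw [Matrix.mulVec_mulVec, Matrix.mul_nonsing_inv _ hT, Matrix.one_mulVec]
  -- translation A′ ↦ A′ − U
  rw [integral_sub_right_eq_self
    (fun y => F (T⁻¹ *ᵥ y) * Real.exp (-(1 / 2 : ℝ) * (y ⬝ᵥ (mMat T Cinv *ᵥ y)))) U]
  -- linear change y = TA, i.e. `∫ h(T⁻¹ y) dy = |det T⁻¹|⁻¹ ∫ h`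
  have hh : AEStronglyMeasurable (fun A : κ → ℝ => F A * Real.exp (-(1 / 2 : ℝ) * (A ⬝ᵥ (Cinv *ᵥ A)))) volume :=
    hF.mul (Real.continuous_exp.comp (continuous_const.mul (continuous_id.dotProduct
      (Matrix.toLin' Cinv).continuous_of_finiteDimensional))).aestronglyMeasurable
  have key := integral_comp_mulVec T⁻¹ hTinv hh
  have h1 : ∀ y : κ → ℝ, F (T⁻¹ *ᵥ y) * Real.exp (-(1 / 2 : ℝ) * (y ⬝ᵥ (mMat T Cinv *ᵥ y))) =
      F (T⁻¹ *ᵥ y) * Real.exp (-(1 / 2 : ℝ) * ((T⁻¹ *ᵥ y) ⬝ᵥ (Cinv *ᵥ (T⁻¹ *ᵥ y)))) := by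
    intro y
    rw [← dotProduct_mMat_mulVec T Cinv hT (T⁻¹ *ᵥ y), hTT]
  simp_rw [h1]
  rw [show (fun y : κ → ℝ => F (T⁻¹ *ᵥ y) * Real.exp (-(1 / 2 : ℝ) * ((T⁻¹ *ᵥ y) ⬝ᵥ (Cinv *ᵥ (T⁻¹ *ᵥ y))))) =
      fun y => (fun A : κ → ℝ => F A * Real.exp (-(1 / 2 : ℝ) * (A ⬝ᵥ (Cinv *ᵥ A)))) (T⁻¹ *ᵥ y) from rfl, key,
    Matrix.det_nonsing_inv, Ring.inverse_eq_inv, abs_inv, inv_inv]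

/-- `e^{−½A′ᵀC⁻¹A′} G_exact(A′) = e^{−½(A′−U)ᵀ(Tᵗʳ)⁻¹C⁻¹T⁻¹(A′−U)}`: `G_exact` IS the density of the transported Gaussian
weight relative to `dμ_{0,ρ₁}(A′)`'s weight. [cite: MagnenRivasseauSeneor1993, (II.44) p.341 tl.36–42] -/
theorem gaussWeight_mul_gExact (T Cinv : Matrix κ κ ℝ) (U A' : κ → ℝ) :
    Real.exp (-(1 / 2 : ℝ) * (A' ⬝ᵥ (Cinv *ᵥ A'))) * gExact T Cinv U A' =
      Real.exp (-(1 / 2 : ℝ) * ((A' - U) ⬝ᵥ (mMat T Cinv *ᵥ (A' - U)))) := by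
  rw [gExact, ← Real.exp_add]
  congr 1
  ring

/-- The numerator of (II.44): `∫ F(T⁻¹(A′−U)) G_exact dμ(A′) = |det T| ∫ F dμ`.
[cite: MagnenRivasseauSeneor1993, (II.44) p.341 tl.36–44] -/
theorem gaussExpect_transport (T Cinv : Matrix κ κ ℝ) (hT : IsUnit T.det) (U : κ → ℝ) {F : (κ → ℝ) → ℝ}
    (hF : AEStronglyMeasurable F volume) :
    gaussExpect Cinv (fun A' => F (T⁻¹ *ᵥ (A' - U)) * gExact T Cinv U A') = |T.det| * gaussExpect Cinv F := by
  unfold gaussExpect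
  have h1 : ∀ A' : κ → ℝ, Real.exp (-(1 / 2 : ℝ) * (A' ⬝ᵥ (Cinv *ᵥ A'))) *
      (F (T⁻¹ *ᵥ (A' - U)) * gExact T Cinv U A') =
      F (T⁻¹ *ᵥ (A' - U)) * Real.exp (-(1 / 2 : ℝ) * ((A' - U) ⬝ᵥ (mMat T Cinv *ᵥ (A' - U)))) := by
    intro A'; rw [← gaussWeight_mul_gExact]; ring
  have h2 : ∀ A : κ → ℝ, Real.exp (-(1 / 2 : ℝ) * (A ⬝ᵥ (Cinv *ᵥ A))) * F A =
      F A * Real.exp (-(1 / 2 : ℝ) * (A ⬝ᵥ (Cinv *ᵥ A))) := fun A => mul_comm _ _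
  simp_rw [h1, h2]
  rw [integral_affine_change T Cinv hT U hF]
  ring

/-- **(II.44) PROVED (finite dimensions, EXACT `G`)**: for the normalised Gaussian `dμ = Z⁻¹e^{−½AᵀC⁻¹A}dA` (READING (FD),
`Z ≠ 0`) and the change of variables `A = T⁻¹(A′ − U)` with `T` invertible,
`∫ F(A) dμ(A) = ∫ F(T⁻¹(A′−U)) G_exact(A′) dμ(A′) / ∫ G_exact(A′) dμ(A′)` — «dμ_{0,ρ₁}(A) = dμ_{0,ρ₁}(A′)
G(A′,γ)/∫G(A′,γ)dμ_{0,ρ₁}(A′)» with the exact `G`. [cite: MagnenRivasseauSeneor1993, (II.44) p.341 tl.36–44] -/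
theorem gaussExpect_affine_change (T : Matrix κ κ ℝ) {Cinv : Matrix κ κ ℝ} (hT : IsUnit T.det)
    (hZ : gaussZ Cinv ≠ 0) (U : κ → ℝ) {F : (κ → ℝ) → ℝ} (hF : AEStronglyMeasurable F volume) :
    gaussExpect Cinv F =
      gaussExpect Cinv (fun A' => F (T⁻¹ *ᵥ (A' - U)) * gExact T Cinv U A') /
        gaussExpect Cinv (gExact T Cinv U) := by
  have hdet : |T.det| ≠ 0 := abs_ne_zero.mpr hT.ne_zero
  have hone : gaussExpect Cinv (fun _ => (1 : ℝ)) = 1 := by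
    unfold gaussExpect gaussZ
    simp only [mul_one]
    exact inv_mul_cancel₀ hZ
  have hden : gaussExpect Cinv (gExact T Cinv U) = |T.det| := by
    have h := gaussExpect_transport T Cinv hT U (F := fun _ => (1 : ℝ)) aestronglyMeasurable_const
    simp only [one_mul] at h
    rw [hone, mul_one] at h
    exact h
  rw [gaussExpect_transport T Cinv hT U hF, hden]
  field_simp

/-! ## §3 (II.45) as printed vs the exact factor of (II.44): both exponents in closed form -/

/-- The printed `H`-combination IS `M − C⁻¹`: `HᵗʳC⁻¹T⁻¹ + (Tᵗʳ)⁻¹C⁻¹H − HᵗʳC⁻¹H = (Tᵗʳ)⁻¹C⁻¹T⁻¹ − C⁻¹` for `H = T⁻¹ − 1`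
(«correction terms in the difference H between T⁻¹ and Id», p.342 tl.1) — pure algebra, no invertibility used.
[cite: MagnenRivasseauSeneor1993, (II.45) p.342 tl.1–4, (II.42) p.341] -/
theorem hMat_combination (T Cinv : Matrix κ κ ℝ) :
    (hMat T)ᵀ * Cinv * T⁻¹ + T⁻¹ᵀ * Cinv * hMat T - (hMat T)ᵀ * Cinv * hMat T = mMat T Cinv - Cinv := by
  unfold hMat mMat
  rw [Matrix.transpose_sub, Matrix.transpose_one]
  noncomm_ring

/-- **The printed exponent of (II.45) in closed form**: `log G_printed(A′) = A′ᵀ(M − C⁻¹)A′ + (A′ᵀMU + UᵀMA′) − UᵀMU`,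
`M = (Tᵗʳ)⁻¹C⁻¹T⁻¹`. [cite: MagnenRivasseauSeneor1993, (II.45) p.342 tl.1–4] -/
theorem gPrinted_eq (T Cinv : Matrix κ κ ℝ) (U A' : κ → ℝ) :
    gPrinted T Cinv U A' = Real.exp (A' ⬝ᵥ ((mMat T Cinv - Cinv) *ᵥ A') +
      (A' ⬝ᵥ (mMat T Cinv *ᵥ U) + U ⬝ᵥ (mMat T Cinv *ᵥ A')) - U ⬝ᵥ (mMat T Cinv *ᵥ U)) := by
  rw [gPrinted, ← Real.exp_add, ← hMat_combination]
  congr 1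
  rw [Matrix.sub_mulVec, Matrix.add_mulVec, dotProduct_sub, dotProduct_add]
  ring

/-- **The exact exponent of (II.44) in closed form**: `log G_exact(A′) = −½A′ᵀ(M − C⁻¹)A′ + ½(A′ᵀMU + UᵀMA′) − ½UᵀMU`.
[cite: MagnenRivasseauSeneor1993, (II.44) p.341 tl.36–42] -/
theorem gExact_eq (T Cinv : Matrix κ κ ℝ) (U A' : κ → ℝ) :
    gExact T Cinv U A' = Real.exp (-(1 / 2 : ℝ) * (A' ⬝ᵥ ((mMat T Cinv - Cinv) *ᵥ A')) +
      (1 / 2 : ℝ) * (A' ⬝ᵥ (mMat T Cinv *ᵥ U) + U ⬝ᵥ (mMat T Cinv *ᵥ A')) -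
        (1 / 2 : ℝ) * (U ⬝ᵥ (mMat T Cinv *ᵥ U))) := by
  rw [gExact]
  congr 1
  rw [Matrix.sub_mulVec, dotProduct_sub, Matrix.mulVec_sub, dotProduct_sub, sub_dotProduct, sub_dotProduct]
  ring

/-- **AS-PRINTED PRECISION (r), exhibited**: the printed (II.45) and the exact factor of (II.44) are related by
`G_printed(A′) = G_exact(A′)⁻² · e^{2(A′ᵀMU + UᵀMA′) − 2UᵀMU}` — i.e. (II.45) drops the Gaussian `−½` on the
quadratic («correction») terms and carries the `U`-terms with the signs shown; since `G` enters (II.49)/(II.78) only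
through the normalised ratio `G/∫G dμ_{0,ρ₁}` of (II.44) («formal manipulations … as a guide», p.341 tl.38), the file
types BOTH and asserts (II.44) for the exact one. Not adjudicated. [cite: MagnenRivasseauSeneor1993, (II.44)–(II.45) p.341–342] -/
theorem gPrinted_eq_gExact_rel (T Cinv : Matrix κ κ ℝ) (U A' : κ → ℝ) :
    gPrinted T Cinv U A' = (gExact T Cinv U A')⁻¹ ^ 2 *
      Real.exp (2 * (A' ⬝ᵥ (mMat T Cinv *ᵥ U) + U ⬝ᵥ (mMat T Cinv *ᵥ A')) - 2 * (U ⬝ᵥ (mMat T Cinv *ᵥ U))) := by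
  rw [gPrinted_eq, gExact_eq, ← Real.exp_neg, ← Real.exp_nat_mul, ← Real.exp_add]
  congr 1
  push_cast
  ring

/-- At `γ = 0` (`T = 1`, `U = 0`: no change of variables) both factors are `1`.
[cite: MagnenRivasseauSeneor1993, (II.44)–(II.45) p.341–342] -/
theorem gPrinted_one_zero (Cinv : Matrix κ κ ℝ) (A' : κ → ℝ) : gPrinted 1 Cinv 0 A' = 1 ∧ gExact 1 Cinv 0 A' = 1 := by
  constructor
  · rw [gPrinted_eq]
    simp [mMat]
  · rw [gExact_eq]
    simp [mMat]

/-! ## §4 The print's `T`: one site = the (II.41) matrix `T(γ(x))`, the configuration = the block-diagonal `⊕_x T(γ(x))`;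
(II.43) «Π_x dA(x) → Π_x dA′(x) Π_x (1 + λ²γ²(x))⁻¹» = the factor `|det T|` of §2 -/

/-- One su(2) site: the `H` of (II.45) IS the `H` of (II.42) — `T(γ)⁻¹ − 1 = H(γ)` for the tree's (II.41)/(II.42)
matrices. [cite: MagnenRivasseauSeneor1993, (II.41)–(II.42) p.341, (II.45) p.342] -/
theorem hMat_Tmat (lam : ℝ) (γ : Fin 3 → ℝ) : hMat (TruncatedGauge.Tmat lam γ) = TruncatedGauge.Hmat lam γ := by
  rw [hMat, TruncatedGauge.Tmat_inv]
  rfl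

/-- One site: `T(γ)` is invertible for every real `λ`, `γ` (`det T(γ) = 1 + λ²|γ|² > 0`).
[cite: MagnenRivasseauSeneor1993, (II.41)–(II.43) p.341] -/
theorem isUnit_det_Tmat (lam : ℝ) (γ : Fin 3 → ℝ) : IsUnit (TruncatedGauge.Tmat lam γ).det := by
  rw [TruncatedGauge.det_Tmat]
  exact (IsUnit.mk0 _ (TruncatedGauge.one_add_sq_mul_normSq_pos lam γ).ne')

/-- One site: `|det T(γ)| = J(γ)⁻¹ = 1 + λ²γ²` — the Jacobian of (II.43). [cite: MagnenRivasseauSeneor1993, (II.43) p.341 tl.33–35] -/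
theorem abs_det_Tmat (lam : ℝ) (γ : Fin 3 → ℝ) :
    |(TruncatedGauge.Tmat lam γ).det| = (TruncatedGauge.jacobianJ lam γ)⁻¹ := by
  rw [TruncatedGauge.det_Tmat, TruncatedGauge.jacobianJ, inv_inv,
    abs_of_pos (TruncatedGauge.one_add_sq_mul_normSq_pos lam γ)]

variable {X : Type*} [Fintype X] [DecidableEq X]

/-- **The configuration-space `T` of p.341**: the block-diagonal matrix `⊕_x T(γ(x))` on `Fin 3 × X` for a finite set
`X` of sites (READING (FD): the window in position space) and an su(2)-valued `γ : X → ℝ³`.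
[cite: MagnenRivasseauSeneor1993, (II.41) p.341, (II.43) p.341 tl.33–35] -/
def blockT (lam : ℝ) (γ : X → Fin 3 → ℝ) : Matrix (Fin 3 × X) (Fin 3 × X) ℝ :=
  Matrix.blockDiagonal fun x => TruncatedGauge.Tmat lam (γ x)

/-- `det ⊕_x T(γ(x)) = Π_x (1 + λ²γ(x)²)`. [cite: MagnenRivasseauSeneor1993, (II.43) p.341 tl.33–35] -/
theorem det_blockT (lam : ℝ) (γ : X → Fin 3 → ℝ) :
    (blockT lam γ).det = ∏ x, (1 + lam ^ 2 * TruncatedGauge.normSq (γ x)) := by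
  rw [blockT, Matrix.det_blockDiagonal]
  exact Finset.prod_congr rfl fun x _ => TruncatedGauge.det_Tmat lam (γ x)

/-- `⊕_x T(γ(x))` is invertible for every `λ`, `γ`. [cite: MagnenRivasseauSeneor1993, (II.41)–(II.43) p.341] -/
theorem isUnit_det_blockT (lam : ℝ) (γ : X → Fin 3 → ℝ) : IsUnit (blockT lam γ).det := by
  rw [det_blockT]
  exact IsUnit.mk0 _ (Finset.prod_pos fun x _ => TruncatedGauge.one_add_sq_mul_normSq_pos lam (γ x)).ne'

/-- **(II.43) in READING (FD)**: the Lebesgue factor of the change of variables `A′ = TA + U` is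
`|det ⊕_x T(γ(x))| = Π_x (1 + λ²γ²(x)) = Π_x J(γ(x))⁻¹` — «Π_x dA(x) → Π_x dA′(x) Π_x (1 + λ²γ²(x))⁻¹».
[cite: MagnenRivasseauSeneor1993, (II.43) p.341 tl.33–35] -/
theorem abs_det_blockT (lam : ℝ) (γ : X → Fin 3 → ℝ) :
    |(blockT lam γ).det| = ∏ x, (TruncatedGauge.jacobianJ lam (γ x))⁻¹ := by
  rw [det_blockT, abs_of_pos (Finset.prod_pos fun x _ => TruncatedGauge.one_add_sq_mul_normSq_pos lam (γ x))]
  exact Finset.prod_congr rfl fun x _ => by rw [TruncatedGauge.jacobianJ, inv_inv]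

/-- **(II.44) for the print's own `T`**: with `T = ⊕_x T(γ(x))` (always invertible) and any shift `U` (in print `U =
∂γ + (λ/2)[γ,∂γ]`), `∫F dμ = ∫ F(T⁻¹(A′−U)) G_exact dμ / ∫ G_exact dμ` for every normalisable `C⁻¹` and every
a.e.-strongly-measurable `F`. [cite: MagnenRivasseauSeneor1993, (II.44) p.341 tl.36–44] -/
theorem gaussExpect_affine_change_blockT (lam : ℝ) (γ : X → Fin 3 → ℝ) {Cinv : Matrix (Fin 3 × X) (Fin 3 × X) ℝ}
    (hZ : gaussZ Cinv ≠ 0) (U : Fin 3 × X → ℝ) {F : (Fin 3 × X → ℝ) → ℝ} (hF : AEStronglyMeasurable F volume) :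
    gaussExpect Cinv F =
      gaussExpect Cinv (fun A' => F ((blockT lam γ)⁻¹ *ᵥ (A' - U)) * gExact (blockT lam γ) Cinv U A') /
        gaussExpect Cinv (gExact (blockT lam γ) Cinv U) :=
  gaussExpect_affine_change (blockT lam γ) (isUnit_det_blockT lam γ) hZ U hF

/-- … and the normalisation `∫ G_exact dμ_{0,ρ₁}(A′) = Π_x (1 + λ²γ²(x))` (a function of `γ` alone, as (II.46)'s
`L_{0,ρ₁}(γ)` is). [cite: MagnenRivasseauSeneor1993, (II.44) p.341 tl.42–44] -/
theorem gaussExpect_gExact_blockT (lam : ℝ) (γ : X → Fin 3 → ℝ) {Cinv : Matrix (Fin 3 × X) (Fin 3 × X) ℝ}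
    (hZ : gaussZ Cinv ≠ 0) (U : Fin 3 × X → ℝ) :
    gaussExpect Cinv (gExact (blockT lam γ) Cinv U) = ∏ x, (1 + lam ^ 2 * TruncatedGauge.normSq (γ x)) := by
  have h := gaussExpect_transport (blockT lam γ) Cinv (isUnit_det_blockT lam γ) U (F := fun _ => (1 : ℝ))
    aestronglyMeasurable_const
  have hone : gaussExpect Cinv (fun _ : Fin 3 × X → ℝ => (1 : ℝ)) = 1 := by
    unfold gaussExpect gaussZ; simp only [mul_one]; exact inv_mul_cancel₀ hZ
  simp only [one_mul] at h
  rw [hone, mul_one, det_blockT,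
    abs_of_pos (Finset.prod_pos fun x _ => TruncatedGauge.one_add_sq_mul_normSq_pos lam (γ x))] at h
  exact h

end GhostGaussian

end MainStatement

end Literature.MathematicalPhysics.QuantumFieldTheory.MagnenRivasseauSeneor1993
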